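import Literature.Computability.QuantumComplexity.QTMCircuitDesc
import Literature.Computability.Complexity.CodeFPLists
import Literature.Computability.Complexity.CodeFPBudgets
import HarnessLib

/-!
# The circuit simulating a quantum Turing machine, V: uniformity

Sixth file of the formalisation of the simulation of (unidirectional) quantum Turing machines by
quantum circuits (Yao 1993; Nishimura–Ozawa 2002, Thm. 4.3). The explicit raw description
`yaoRaw M D n (p n)` of the simulating circuits (`QTMCircuitDesc.lean`, `rawDesc_yaoFamily`) is
computed on codes from the unary input `1ⁿ` by a composition of the typed polynomial-time
combinators of `Complexity/CodeFP.lean` (loops over unary ranges, binary arithmetic on wire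
indices, fixed gate templates): **`isUniform_yaoFamily`** — the simulating family
`yaoFamily M D p` is polynomial-time uniform (Nishimura–Ozawa 2002, §2.2: the code of `Kₙ` is
computable by a DTM in time polynomial in `n`; Arora–Barak 2009, §6.2: "output the description
gate by gate"). No machine is written by hand and no named fact is introduced.

## References

* H. Nishimura, M. Ozawa, *Computational complexity of uniform quantum circuit families and
  quantum Turing machines*, Theoret. Comput. Sci. 276 (2002) 147–181, §2.2 and Thm. 4.3
  [NishimuraOzawa2002].
* S. Arora, B. Barak, *Computational Complexity: A Modern Approach*, CUP 2009, §1.3 (closure of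
  polynomial time under composition and bounded loops), §6.1–6.2 [AroraBarak2009].
-/

noncomputable section

namespace Literature.Computability.QuantumComplexity

namespace YaoSim

open Cryptography QTM Function Turing RevDesc Complexity Complexity.CodeFP
open scoped BigOperators

variable {M : QTM}

/-! ### Gate templates -/

/-- Instantiating a template (symbol code, wire selectors among three wires) at the wires
`a, b, c`. [cite: AroraBarak2009, §6.1] -/
def instTpl (tpl : List (ℕ × List (Fin 3))) (a b c : ℕ) : List RawGate :=
  tpl.map fun e => (false, (e.1, e.2.map ![a, b, c]))

/-- The template of the Fredkin word `cswap c a b` = `CNOT b a; Toffoli c a b; CNOT b a` compiled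
into Clifford+`T` (selectors: `0 ↦ c`, `1 ↦ a`, `2 ↦ b`). [cite: NielsenChuang2010, §4.3 Fig. 4.9] -/
def cswapTpl : List (ℕ × List (Fin 3)) :=
  [(3, [2, 1]),
    (0, [2]), (2, [0]), (2, [1]), (2, [2]), (3, [0, 1]), (1, [1]), (1, [1]), (1, [1]), (2, [1]), (3, [1, 2]),
    (2, [2]), (3, [0, 2]), (1, [2]), (1, [2]), (1, [2]), (2, [2]), (3, [1, 2]), (1, [2]), (1, [2]), (1, [2]),
    (2, [2]), (3, [0, 2]), (3, [0, 1]), (0, [2]),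
    (3, [2, 1])]

/-- The template of `NOT a` = `H S S H`. [cite: NielsenChuang2010, Ex. 4.18] -/
def notTpl : List (ℕ × List (Fin 3)) := [(0, [0]), (1, [0]), (1, [0]), (0, [0])]

/-- The template of `CNOT a b`. [folklore] -/
def cnotTpl : List (ℕ × List (Fin 3)) := [(3, [0, 1])]

/-- The raw gates of a Fredkin word are its template. [folklore] -/
theorem rawOfOps_cswap (c a b : ℕ) : rawOfOps (cswap c a b) = instTpl cswapTpl c a b := rfl

/-- The raw gates of a negation. [folklore] -/
theorem rawOfOp_not (a : ℕ) : rawOfOp (ClOp.not a) = instTpl notTpl a a a := rfl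

/-- The raw gates of a `CNOT`. [folklore] -/
theorem rawOfOp_cnot (a b : ℕ) : rawOfOp (ClOp.cnot a b) = instTpl cnotTpl a b b := rfl

/-- `rawOfOps` of a concatenation. [folklore] -/
theorem rawOfOps_append (l₁ l₂ : List (ClOp ℕ)) : rawOfOps (l₁ ++ l₂) = rawOfOps l₁ ++ rawOfOps l₂ :=
  List.flatMap_append

/-- `rawOfOps` of a `flatMap`. [folklore] -/
theorem rawOfOps_flatMap {α : Type*} (l : List α) (f : α → List (ClOp ℕ)) :
    rawOfOps (l.flatMap f) = l.flatMap fun a => rawOfOps (f a) := by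
  induction l with
  | nil => rfl
  | cons a l ih => rw [List.flatMap_cons, rawOfOps_append, ih, List.flatMap_cons]

/-- `rawOfOps` of a `map`. [folklore] -/
theorem rawOfOps_map {α : Type*} (l : List α) (f : α → ClOp ℕ) :
    rawOfOps (l.map f) = l.flatMap fun a => rawOfOp (f a) := by
  rw [rawOfOps, List.flatMap_map]

/-- `rawOfOps` of a singleton. [folklore] -/
theorem rawOfOps_singleton (op : ClOp ℕ) : rawOfOps [op] = rawOfOp op := by
  simp [rawOfOps]

/-- `rawOfOps` of a cons. [folklore] -/
theorem rawOfOps_cons (op : ClOp ℕ) (l : List (ClOp ℕ)) : rawOfOps (op :: l) = rawOfOp op ++ rawOfOps l := rfl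

section Templates

variable {α : Type} {eα : α → List Bool}

/-- A list of wire selections among three computed wires is computed on codes. [folklore] -/
theorem codeFP_selWires {fa fb fc : α → ℕ} (ha : CodeFP eα natE fa) (hb : CodeFP eα natE fb)
    (hc : CodeFP eα natE fc) :
    ∀ ws : List (Fin 3), CodeFP eα (rawE natE) (fun x => ws.map ![fa x, fb x, fc x])
  | [] => CodeFP.const eα []
  | w :: ws => by
    have hw : CodeFP eα natE (fun x => (![fa x, fb x, fc x] : Fin 3 → ℕ) w) := by
      fin_cases w
      · exact ha
      · exact hb
      · exact hc
    exact ((rawCons natE).comp (hw.pair (codeFP_selWires ha hb hc ws))).congr fun x => rfl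

/-- **Template instantiation at computed wires is computed on codes.** [cite: AroraBarak2009, §1.3] -/
theorem codeFP_instTpl {fa fb fc : α → ℕ} (ha : CodeFP eα natE fa) (hb : CodeFP eα natE fb)
    (hc : CodeFP eα natE fc) :
    ∀ tpl : List (ℕ × List (Fin 3)), CodeFP eα (rawE RawGate.E) (fun x => instTpl tpl (fa x) (fb x) (fc x))
  | [] => CodeFP.const eα []
  | e :: tpl => by
    have hitem : CodeFP eα RawGate.E (fun x => ((false, (e.1, e.2.map ![fa x, fb x, fc x])) : RawGate)) :=
      (RawGate.codeFP_mk.comp ((CodeFP.const eα false).pair ((CodeFP.const eα e.1).pair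
        ((listOfRaw natE).comp (codeFP_selWires ha hb hc e.2))))).congr fun x => rfl
    exact ((rawCons RawGate.E).comp (hitem.pair (codeFP_instTpl ha hb hc tpl))).congr fun x => rfl

end Templates

/-! ### The numeric context `(n, T)` and the layout quantities on codes -/

section Ctx

/-- The code of the numeric context `(n, T)` (binary). [folklore] -/
abbrev σE : ℕ × ℕ → List Bool := pairE natE natE

/-- The window size from the context. [folklore] -/
def Wc (s : ℕ × ℕ) : ℕ := 2 * s.2 + s.1 + 1

variable (M)

/-- The base of the symbol register from the context. [folklore] -/
def R0c (s : ℕ × ℕ) : ℕ := s.1 + kq M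
/-- The base of the cells from the context. [folklore] -/
def C0c (s : ℕ × ℕ) : ℕ := s.1 + (kq M + ks M + 1 + 1)
/-- The base of the head track from the context. [folklore] -/
def H0c (s : ℕ × ℕ) : ℕ := s.1 + (kq M + ks M + 1 + 1 + Wc s * ks M)
/-- The direction wire from the context. [folklore] -/
def D0c (s : ℕ × ℕ) : ℕ := s.1 + (kq M + ks M)
/-- The answer wire from the context. [folklore] -/
def A0c (s : ℕ × ℕ) : ℕ := s.1 + (kq M + ks M + 1)

variable {M}

/-- `Wc` on codes. [folklore] -/
theorem codeFP_Wc : CodeFP σE natE Wc :=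
  (natAdd.comp ((natAdd.comp ((natMul.comp ((CodeFP.const σE 2).pair (CodeFP.snd natE natE))).pair
    (CodeFP.fst natE natE))).pair (CodeFP.const σE 1))).congr fun _ => rfl

/-- `R0c` on codes. [folklore] -/
theorem codeFP_R0c : CodeFP σE natE (R0c M) :=
  (natAdd.comp ((CodeFP.fst natE natE).pair (CodeFP.const σE (kq M)))).congr fun _ => rfl
/-- `C0c` on codes. [folklore] -/
theorem codeFP_C0c : CodeFP σE natE (C0c M) :=
  (natAdd.comp ((CodeFP.fst natE natE).pair (CodeFP.const σE (kq M + ks M + 1 + 1)))).congr fun _ => rfl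
/-- `D0c` on codes. [folklore] -/
theorem codeFP_D0c : CodeFP σE natE (D0c M) :=
  (natAdd.comp ((CodeFP.fst natE natE).pair (CodeFP.const σE (kq M + ks M)))).congr fun _ => rfl
/-- `A0c` on codes. [folklore] -/
theorem codeFP_A0c : CodeFP σE natE (A0c M) :=
  (natAdd.comp ((CodeFP.fst natE natE).pair (CodeFP.const σE (kq M + ks M + 1)))).congr fun _ => rfl
/-- `H0c` on codes. [folklore] -/
theorem codeFP_H0c : CodeFP σE natE (H0c M) :=
  (natAdd.comp ((CodeFP.fst natE natE).pair (natAdd.comp ((CodeFP.const σE (kq M + ks M + 1 + 1)).pair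
    (natMul.comp (codeFP_Wc.pair (CodeFP.const σE (ks M)))))))).congr fun _ => rfl

end Ctx

/-! ### The raw pieces as functions of the context, and their computation on codes -/

section Pieces

variable (M)

/-- The raw gates of `fetch`, from the context. [folklore] -/
def fetchItem (q : ((ℕ × ℕ) × ℕ) × ℕ) : List RawGate :=
  instTpl cswapTpl (H0c M q.1.1 + q.1.2) (C0c M q.1.1 + (q.2 + ks M * q.1.2)) (R0c M q.1.1 + q.2)

/-- The raw gates of `fetch` for one cell, from the context. [folklore] -/
def fetchCell (q : (ℕ × ℕ) × ℕ) : List RawGate :=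
  ((List.range (ks M)).map fun t => fetchItem M (q, t)).flatten

/-- The raw gates of `fetch`, over a list of cell indices. [folklore] -/
def fetchOver (q : (ℕ × ℕ) × List ℕ) : List RawGate := (q.2.map fun j => fetchCell M (q.1, j)).flatten

variable {M}

/-- `rawOfOps fetchN` from the context. [folklore] -/
theorem rawOfOps_fetchN (n T : ℕ) :
    rawOfOps (fetchN M n (Wd n T)) = fetchOver M ((n, T), List.range (Wd n T)) := by
  rw [fetchN, rawOfOps_flatMap, fetchOver, List.flatMap_def]
  congr 1
  refine List.map_congr_left fun j _ => ?_
  rw [rawOfOps_flatMap, fetchCell, List.flatMap_def]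
  rfl

/-- `fetchItem` on codes. [folklore] -/
theorem codeFP_fetchItem : CodeFP (pairE (pairE σE natE) natE) (rawE RawGate.E) (fetchItem M) := by
  have hs : CodeFP (pairE (pairE σE natE) natE) σE (fun q => q.1.1) := (CodeFP.fst _ _).fst'
  have hj : CodeFP (pairE (pairE σE natE) natE) natE (fun q => q.1.2) := (CodeFP.fst _ _).snd'
  have ht : CodeFP (pairE (pairE σE natE) natE) natE (fun q => q.2) := CodeFP.snd _ _
  have ha : CodeFP (pairE (pairE σE natE) natE) natE (fun q => H0c M q.1.1 + q.1.2) :=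
    natAdd.comp ((codeFP_H0c.comp hs).pair hj)
  have hb : CodeFP (pairE (pairE σE natE) natE) natE (fun q => C0c M q.1.1 + (q.2 + ks M * q.1.2)) :=
    natAdd.comp ((codeFP_C0c.comp hs).pair (natAdd.comp (ht.pair (natMul.comp ((CodeFP.const _ (ks M)).pair hj)))))
  have hc : CodeFP (pairE (pairE σE natE) natE) natE (fun q => R0c M q.1.1 + q.2) :=
    natAdd.comp ((codeFP_R0c.comp hs).pair ht)
  exact (codeFP_instTpl ha hb hc cswapTpl).congr fun _ => rfl

/-- `fetchCell` on codes. [folklore] -/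
theorem codeFP_fetchCell : CodeFP (pairE σE natE) (rawE RawGate.E) (fetchCell M) :=
  ((flatten RawGate.E).comp ((map codeFP_fetchItem).comp ((CodeFP.id _).pair
    (CodeFP.const _ (List.range (ks M)))))).congr fun _ => rfl

/-- `fetchOver` on codes. [folklore] -/
theorem codeFP_fetchOver : CodeFP (pairE σE (rawE natE)) (rawE RawGate.E) (fetchOver M) :=
  ((flatten RawGate.E).comp (map codeFP_fetchCell)).congr fun _ => rfl

variable (M)

/-- The `CNOT`s of the direction bit, from the context. [folklore] -/
def xorRaw (D : M.Λ → Dir) (s : ℕ × ℕ) : List RawGate :=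
  ((rightIdx M D).map fun a => instTpl cnotTpl (s.1 + a) (D0c M s) (D0c M s)).flatten

/-- One Fredkin word of the right rotation (forward index `k` over `W - 1` words). [folklore] -/
def rotRItem (q : (ℕ × ℕ) × ℕ) : List RawGate :=
  instTpl cswapTpl (D0c M q.1) (H0c M q.1 + (Wc q.1 - 1 - 1 - q.2)) (H0c M q.1 + (Wc q.1 - 1 - 1 - q.2 + 1))

/-- One Fredkin word of the left rotation. [folklore] -/
def rotLItem (q : (ℕ × ℕ) × ℕ) : List RawGate :=
  instTpl cswapTpl (D0c M q.1) (H0c M q.1 + q.2) (H0c M q.1 + (q.2 + 1))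

/-- The raw gates of `move`, over the list of word indices `[0, W-1)`. [folklore] -/
def moveOver (D : M.Λ → Dir) (q : (ℕ × ℕ) × List ℕ) : List RawGate :=
  xorRaw M D q.1 ++ ((q.2.map fun k => rotRItem M (q.1, k)).flatten ++
    (instTpl notTpl (D0c M q.1) (D0c M q.1) (D0c M q.1) ++ ((q.2.map fun j => rotLItem M (q.1, j)).flatten ++
      (instTpl notTpl (D0c M q.1) (D0c M q.1) (D0c M q.1) ++ xorRaw M D q.1))))

variable {M}

/-- The reversed range as a map. [folklore] -/
theorem reverse_range_eq_map (m : ℕ) : (List.range m).reverse = (List.range m).map fun k => m - 1 - k := by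
  have h := @List.reverse_range' 0 m
  rw [← List.range_eq_range'] at h
  rw [h]
  simp

/-- `rawOfOps moveN` from the context. [folklore] -/
theorem rawOfOps_moveN (D : M.Λ → Dir) (n T : ℕ) :
    rawOfOps (moveN M D n (Wd n T)) = moveOver M D ((n, T), List.range (Wd n T - 1)) := by
  have hx : rawOfOps (xorInto ((rightIdx M D).map (n + ·)) (D0 M n)) = xorRaw M D (n, T) := by
    rw [xorInto, List.map_map, rawOfOps_map, xorRaw, List.flatMap_def]
    rfl
  rw [moveN, rawOfOps_append, rawOfOps_append, rawOfOps_append, rawOfOps_append, rawOfOps_append, hx,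
    reverse_range_eq_map, List.flatMap_map, rawOfOps_flatMap, rawOfOps_flatMap, rawOfOps_singleton,
    rawOfOp_not, moveOver, List.flatMap_def, List.flatMap_def]
  rfl

/-- `xorRaw` on codes. [folklore] -/
theorem codeFP_xorRaw (D : M.Λ → Dir) : CodeFP σE (rawE RawGate.E) (xorRaw M D) := by
  have hitem : CodeFP (pairE σE natE) (rawE RawGate.E)
      (fun q => instTpl cnotTpl (q.1.1 + q.2) (D0c M q.1) (D0c M q.1)) :=
    codeFP_instTpl (natAdd.comp ((CodeFP.fst _ _).fst'.pair (CodeFP.snd _ _)))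
      (codeFP_D0c.comp (CodeFP.fst _ _)) (codeFP_D0c.comp (CodeFP.fst _ _)) cnotTpl
  exact ((flatten RawGate.E).comp ((map hitem).comp ((CodeFP.id _).pair
    (CodeFP.const _ (rightIdx M D))))).congr fun _ => rfl

/-- `rotRItem` on codes. [folklore] -/
theorem codeFP_rotRItem : CodeFP (pairE σE natE) (rawE RawGate.E) (rotRItem M) := by
  have hs : CodeFP (pairE σE natE) σE (fun q => q.1) := CodeFP.fst _ _
  have hk : CodeFP (pairE σE natE) natE (fun q => q.2) := CodeFP.snd _ _
  have hidx : CodeFP (pairE σE natE) natE (fun q => Wc q.1 - 1 - 1 - q.2) :=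
    natSub.comp ((natSub.comp ((natSub.comp ((codeFP_Wc.comp hs).pair (CodeFP.const _ 1))).pair
      (CodeFP.const _ 1))).pair hk)
  exact codeFP_instTpl (codeFP_D0c.comp hs) (natAdd.comp ((codeFP_H0c.comp hs).pair hidx))
    (natAdd.comp ((codeFP_H0c.comp hs).pair (natAdd.comp (hidx.pair (CodeFP.const _ 1))))) cswapTpl

/-- `rotLItem` on codes. [folklore] -/
theorem codeFP_rotLItem : CodeFP (pairE σE natE) (rawE RawGate.E) (rotLItem M) := by
  have hs : CodeFP (pairE σE natE) σE (fun q => q.1) := CodeFP.fst _ _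
  have hk : CodeFP (pairE σE natE) natE (fun q => q.2) := CodeFP.snd _ _
  exact codeFP_instTpl (codeFP_D0c.comp hs) (natAdd.comp ((codeFP_H0c.comp hs).pair hk))
    (natAdd.comp ((codeFP_H0c.comp hs).pair (natAdd.comp (hk.pair (CodeFP.const _ 1))))) cswapTpl

/-- `moveOver` on codes. [folklore] -/
theorem codeFP_moveOver (D : M.Λ → Dir) : CodeFP (pairE σE (rawE natE)) (rawE RawGate.E) (moveOver M D) := by
  have hs : CodeFP (pairE σE (rawE natE)) σE (fun q => q.1) := CodeFP.fst _ _
  have hx : CodeFP (pairE σE (rawE natE)) (rawE RawGate.E) (fun q => xorRaw M D q.1) := (codeFP_xorRaw D).comp hs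
  have hnot : CodeFP (pairE σE (rawE natE)) (rawE RawGate.E)
      (fun q => instTpl notTpl (D0c M q.1) (D0c M q.1) (D0c M q.1)) :=
    codeFP_instTpl (codeFP_D0c.comp hs) (codeFP_D0c.comp hs) (codeFP_D0c.comp hs) notTpl
  have hR : CodeFP (pairE σE (rawE natE)) (rawE RawGate.E) (fun q => (q.2.map fun k => rotRItem M (q.1, k)).flatten) :=
    (flatten RawGate.E).comp (map codeFP_rotRItem)
  have hL : CodeFP (pairE σE (rawE natE)) (rawE RawGate.E) (fun q => (q.2.map fun j => rotLItem M (q.1, j)).flatten) :=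
    (flatten RawGate.E).comp (map codeFP_rotLItem)
  have happ := rawAppend RawGate.E
  exact (happ.comp (hx.pair (happ.comp (hR.pair (happ.comp (hnot.pair (happ.comp (hL.pair
    (happ.comp (hnot.pair hx)))))))))).congr fun _ => rfl

variable (M)

/-- The blank-cell negations of `initOps`, over the list of window indices. [folklore] -/
def blankItem (q : (ℕ × ℕ) × ℕ) : List RawGate :=
  instTpl notTpl (C0c M q.1 + ((Fintype.equivFin M.Γ default : ℕ) + ks M * q.2))
    (C0c M q.1 + ((Fintype.equivFin M.Γ default : ℕ) + ks M * q.2))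
    (C0c M q.1 + ((Fintype.equivFin M.Γ default : ℕ) + ks M * q.2))

/-- Is `j` a non-input cell? [folklore] -/
def blankTest (q : (ℕ × ℕ) × ℕ) : Bool := !decide (q.1.2 ≤ q.2 ∧ q.2 < q.1.2 + q.1.1)

/-- One selective write of an input symbol bit: context `(s, i)`, symbol number `t`. [folklore] -/
def selItem (q : ((ℕ × ℕ) × ℕ) × ℕ) : List RawGate :=
  (if eBit M false q.2 then
      instTpl notTpl (C0c M q.1.1 + (q.2 + ks M * (q.1.1.2 + q.1.2))) (C0c M q.1.1 + (q.2 + ks M * (q.1.1.2 + q.1.2)))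
        (C0c M q.1.1 + (q.2 + ks M * (q.1.1.2 + q.1.2)))
    else []) ++
    (if eBit M false q.2 = eBit M true q.2 then []
    else instTpl cnotTpl q.1.2 (C0c M q.1.1 + (q.2 + ks M * (q.1.1.2 + q.1.2)))
      (C0c M q.1.1 + (q.2 + ks M * (q.1.1.2 + q.1.2))))

/-- The input-loading writes of one input cell. [folklore] -/
def selCell (q : (ℕ × ℕ) × ℕ) : List RawGate := ((List.range (ks M)).map fun t => selItem M (q, t)).flatten

/-- The blank-cell part of `initOps`, over the window indices. [folklore] -/
def blankPart (q : (ℕ × ℕ) × List ℕ) : List RawGate :=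
  ((q.2.filter fun j => blankTest (q.1, j)).map fun j => blankItem M (q.1, j)).flatten

/-- The input-loading part of `initOps`, over the input indices. [folklore] -/
def inputPart (q : (ℕ × ℕ) × List ℕ) : List RawGate := (q.2.map fun i => selCell M (q.1, i)).flatten

/-- The start state and the head marker. [folklore] -/
def tailPart (s : ℕ × ℕ) : List RawGate :=
  instTpl notTpl (s.1 + (Fintype.equivFin M.Λ M.start : ℕ)) (s.1 + (Fintype.equivFin M.Λ M.start : ℕ))
      (s.1 + (Fintype.equivFin M.Λ M.start : ℕ)) ++
    instTpl notTpl (H0c M s + s.2) (H0c M s + s.2) (H0c M s + s.2)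

/-- The raw gates of `initOps`, over the lists of window indices and input indices. [folklore] -/
def initOver (q : (ℕ × ℕ) × (List ℕ × List ℕ)) : List RawGate :=
  blankPart M (q.1, q.2.1) ++ (inputPart M (q.1, q.2.2) ++ tailPart M q.1)

variable {M}

/-- `rawOfOps initN` from the context. [folklore] -/
theorem rawOfOps_initN (n T : ℕ) :
    rawOfOps (initN M n T) = initOver M ((n, T), (List.range (Wd n T), List.range n)) := by
  have hB : ∀ i, rawOfOps (writeSelN M n i (T + i)) = selCell M ((n, T), i) := fun i => by
    rw [writeSelN, writeSel, rawOfOps_flatMap, selCell, List.flatMap_def]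
    congr 1
    refine List.map_congr_left fun t _ => ?_
    rw [rawOfOps_append, selItem]
    congr 1 <;> split_ifs <;> rfl
  have hC : rawOfOps [ClOp.not (n + (Fintype.equivFin M.Λ M.start : ℕ)), ClOp.not (H0 M n (Wd n T) + T)] =
      tailPart M (n, T) := by
    rw [rawOfOps_cons, rawOfOps_singleton, rawOfOp_not, rawOfOp_not]
    rfl
  rw [initN, List.append_assoc, rawOfOps_append, rawOfOps_append, rawOfOps_map, rawOfOps_flatMap, initOver,
    hC, blankPart, inputPart, List.flatMap_def, List.flatMap_def]
  simp only [hB]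
  rfl

/-- `blankItem` on codes. [folklore] -/
theorem codeFP_blankItem : CodeFP (pairE σE natE) (rawE RawGate.E) (blankItem M) := by
  have hw : CodeFP (pairE σE natE) natE
      (fun q => C0c M q.1 + ((Fintype.equivFin M.Γ default : ℕ) + ks M * q.2)) :=
    natAdd.comp ((codeFP_C0c.comp (CodeFP.fst _ _)).pair (natAdd.comp ((CodeFP.const _ _).pair
      (natMul.comp ((CodeFP.const _ (ks M)).pair (CodeFP.snd _ _))))))
  exact codeFP_instTpl hw hw hw notTpl

/-- `blankTest` on codes. [folklore] -/
theorem codeFP_blankTest : CodeFP (pairE σE natE) bitE blankTest := by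
  have hT : CodeFP (pairE σE natE) natE (fun q => q.1.2) := (CodeFP.fst _ _).snd'
  have hn : CodeFP (pairE σE natE) natE (fun q => q.1.1) := (CodeFP.fst _ _).fst'
  have hj : CodeFP (pairE σE natE) natE (fun q => q.2) := CodeFP.snd _ _
  exact ((natLe.comp (hT.pair hj)).and (natLt.comp (hj.pair (natAdd.comp (hT.pair hn))))).not.congr fun q => by
    rw [blankTest, Bool.decide_and]

/-- `selItem` on codes. [folklore] -/
theorem codeFP_selItem : CodeFP (pairE (pairE σE natE) natE) (rawE RawGate.E) (selItem M) := by
  have hs : CodeFP (pairE (pairE σE natE) natE) σE (fun q => q.1.1) := (CodeFP.fst _ _).fst'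
  have hi : CodeFP (pairE (pairE σE natE) natE) natE (fun q => q.1.2) := (CodeFP.fst _ _).snd'
  have ht : CodeFP (pairE (pairE σE natE) natE) natE (fun q => q.2) := CodeFP.snd _ _
  have hw : CodeFP (pairE (pairE σE natE) natE) natE
      (fun q => C0c M q.1.1 + (q.2 + ks M * (q.1.1.2 + q.1.2))) :=
    natAdd.comp ((codeFP_C0c.comp hs).pair (natAdd.comp (ht.pair (natMul.comp ((CodeFP.const _ (ks M)).pair
      (natAdd.comp (hs.snd'.pair hi)))))))
  have he : ∀ b, CodeFP (pairE (pairE σE natE) natE) bitE (fun q => eBit M b q.2) := fun b =>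
    (natEq.comp ((CodeFP.const _ (Fintype.equivFin M.Γ (M.embed b) : ℕ)).pair ht)).congr fun _ => rfl
  have h1 : CodeFP (pairE (pairE σE natE) natE) (rawE RawGate.E)
      (fun q => if eBit M false q.2 then instTpl notTpl (C0c M q.1.1 + (q.2 + ks M * (q.1.1.2 + q.1.2)))
        (C0c M q.1.1 + (q.2 + ks M * (q.1.1.2 + q.1.2))) (C0c M q.1.1 + (q.2 + ks M * (q.1.1.2 + q.1.2))) else []) :=
    (he false).ite (codeFP_instTpl hw hw hw notTpl) (CodeFP.const _ [])
  have heq : CodeFP (pairE (pairE σE natE) natE) bitE (fun q => decide (eBit M false q.2 = eBit M true q.2)) :=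
    (CodeFP.eq bitE_injective).comp ((he false).pair (he true))
  have h2 : CodeFP (pairE (pairE σE natE) natE) (rawE RawGate.E)
      (fun q => if eBit M false q.2 = eBit M true q.2 then []
        else instTpl cnotTpl q.1.2 (C0c M q.1.1 + (q.2 + ks M * (q.1.1.2 + q.1.2)))
          (C0c M q.1.1 + (q.2 + ks M * (q.1.1.2 + q.1.2)))) :=
    (heq.ite (CodeFP.const _ []) (codeFP_instTpl hi hw hw cnotTpl)).congr fun q => by
      by_cases h : eBit M false q.2 = eBit M true q.2 <;> simp [h]
  exact ((rawAppend RawGate.E).comp (h1.pair h2)).congr fun _ => rfl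

/-- `selCell` on codes. [folklore] -/
theorem codeFP_selCell : CodeFP (pairE σE natE) (rawE RawGate.E) (selCell M) :=
  ((flatten RawGate.E).comp ((map codeFP_selItem).comp ((CodeFP.id _).pair
    (CodeFP.const _ (List.range (ks M)))))).congr fun _ => rfl

/-- `blankPart` on codes. [folklore] -/
theorem codeFP_blankPart : CodeFP (pairE σE (rawE natE)) (rawE RawGate.E) (blankPart M) :=
  ((flatten RawGate.E).comp ((map codeFP_blankItem).comp ((CodeFP.fst _ _).pair
    (filter codeFP_blankTest)))).congr fun _ => rfl

/-- `inputPart` on codes. [folklore] -/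
theorem codeFP_inputPart : CodeFP (pairE σE (rawE natE)) (rawE RawGate.E) (inputPart M) :=
  ((flatten RawGate.E).comp (map codeFP_selCell)).congr fun _ => rfl

/-- `tailPart` on codes. [folklore] -/
theorem codeFP_tailPart : CodeFP σE (rawE RawGate.E) (tailPart M) := by
  have hst : CodeFP σE natE (fun s => s.1 + (Fintype.equivFin M.Λ M.start : ℕ)) :=
    natAdd.comp ((CodeFP.fst _ _).pair (CodeFP.const _ _))
  have hhd : CodeFP σE natE (fun s => H0c M s + s.2) := natAdd.comp (codeFP_H0c.pair (CodeFP.snd _ _))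
  exact ((rawAppend RawGate.E).comp ((codeFP_instTpl hst hst hst notTpl).pair
    (codeFP_instTpl hhd hhd hhd notTpl))).congr fun _ => rfl

/-- `initOver` on codes. [folklore] -/
theorem codeFP_initOver : CodeFP (pairE σE (pairE (rawE natE) (rawE natE))) (rawE RawGate.E) (initOver M) := by
  have hs : CodeFP (pairE σE (pairE (rawE natE) (rawE natE))) σE (fun q => q.1) := CodeFP.fst _ _
  have hlW : CodeFP (pairE σE (pairE (rawE natE) (rawE natE))) (rawE natE) (fun q => q.2.1) := (CodeFP.snd _ _).fst'
  have hln : CodeFP (pairE σE (pairE (rawE natE) (rawE natE))) (rawE natE) (fun q => q.2.2) := (CodeFP.snd _ _).snd'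
  have hA := (codeFP_blankPart (M := M)).comp (hs.pair hlW)
  have hB := (codeFP_inputPart (M := M)).comp (hs.pair hln)
  have hC := (codeFP_tailPart (M := M)).comp hs
  have happ := rawAppend RawGate.E
  exact (happ.comp (hA.pair (happ.comp (hB.pair hC)))).congr fun _ => rfl

variable (M)

/-- The raw gates of `outputOps`, from the context (wire `0` of the circuit is `0`). [folklore] -/
def outputRaw (s : ℕ × ℕ) : List RawGate :=
  instTpl cnotTpl (s.1 + (Fintype.equivFin M.Λ M.accept : ℕ)) (A0c M s) (A0c M s) ++
    (instTpl cnotTpl (A0c M s) 0 0 ++ (instTpl cnotTpl 0 (A0c M s) (A0c M s) ++ instTpl cnotTpl (A0c M s) 0 0))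

/-- The raw local gate, from the context. [folklore] -/
def locRawc (s : ℕ × ℕ) : RawGate := (false, (4, (List.range (kq M + ks M)).map (s.1 + ·)))

variable {M}

/-- `rawOfOps outputN` from the context. [folklore] -/
theorem rawOfOps_outputN (n T : ℕ) : rawOfOps (outputN M n) = outputRaw M (n, T) := by
  simp only [outputN, rawOfOps_cons, rawOfOp_cnot]
  rfl

/-- `outputRaw` on codes. [folklore] -/
theorem codeFP_outputRaw : CodeFP σE (rawE RawGate.E) (outputRaw M) := by
  have hacc : CodeFP σE natE (fun s => s.1 + (Fintype.equivFin M.Λ M.accept : ℕ)) :=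
    natAdd.comp ((CodeFP.fst _ _).pair (CodeFP.const _ _))
  have h0 : CodeFP σE natE (fun _ => 0) := CodeFP.const _ 0
  have happ := rawAppend RawGate.E
  exact (happ.comp ((codeFP_instTpl hacc codeFP_A0c codeFP_A0c cnotTpl).pair (happ.comp
    ((codeFP_instTpl codeFP_A0c h0 h0 cnotTpl).pair (happ.comp ((codeFP_instTpl h0 codeFP_A0c codeFP_A0c cnotTpl).pair
      (codeFP_instTpl codeFP_A0c h0 h0 cnotTpl))))))).congr fun _ => rfl

/-- `locRawc` on codes. [folklore] -/
theorem codeFP_locRawc : CodeFP σE RawGate.E (locRawc M) := by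
  have hws : CodeFP σE (rawE natE) (fun s => (List.range (kq M + ks M)).map (s.1 + ·)) :=
    ((map (natAdd.comp ((CodeFP.fst _ _).fst'.pair (CodeFP.snd _ _)))).comp ((CodeFP.id _).pair
      (CodeFP.const _ (List.range (kq M + ks M))))).congr fun _ => rfl
  exact (RawGate.codeFP_mk.comp ((CodeFP.const _ false).pair ((CodeFP.const _ 4).pair
    ((listOfRaw natE).comp hws)))).congr fun _ => rfl

variable (M)

/-- All the lists the description loops over, with the context: `((n, T), ([0, W), ([0, W-1),
([0, n), T))))`, the last `T` being used in unary. [folklore] -/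
abbrev Loops : Type := (ℕ × ℕ) × (List ℕ × (List ℕ × (List ℕ × ℕ)))

/-- The code of `Loops`. [folklore] -/
abbrev Loops.E : Loops → List Bool :=
  pairE σE (pairE (rawE natE) (pairE (rawE natE) (pairE (rawE natE) unE)))

/-- The raw gates of one step, from the loops. [folklore] -/
def stepOver (D : M.Λ → Dir) (L : Loops) : List RawGate :=
  fetchOver M (L.1, L.2.1) ++ ([locRawc M L.1] ++ (fetchOver M (L.1, L.2.1) ++ moveOver M D (L.1, L.2.2.1)))

/-- The raw gates of the whole circuit, from the loops. [folklore] -/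
def yaoOver (D : M.Λ → Dir) (L : Loops) : List RawGate :=
  initOver M (L.1, (L.2.1, L.2.2.2.1)) ++ ((List.replicate L.2.2.2.2 (stepOver M D L)).flatten ++ outputRaw M L.1)

/-- The loops of input length `n` and `T` steps. [folklore] -/
def loopsOf (n T : ℕ) : Loops :=
  ((n, T), (List.range (Wd n T), (List.range (Wd n T - 1), (List.range n, T))))

variable {M}

/-- **`yaoRaw` is `yaoOver` of the loops.** [folklore] -/
theorem yaoRaw_eq_yaoOver (D : M.Λ → Dir) (n T : ℕ) : yaoRaw M D n T = yaoOver M D (loopsOf n T) := by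
  rw [yaoRaw, yaoOver, rawOfOps_initN, rawOfOps_outputN n T]
  simp only [loopsOf, stepRaw, stepOver, rawOfOps_fetchN, rawOfOps_moveN, locRaw, locRawc]

/-- `stepOver` on codes. [folklore] -/
theorem codeFP_stepOver (D : M.Λ → Dir) : CodeFP (Loops.E) (rawE RawGate.E) (stepOver M D) := by
  have hctx : CodeFP Loops.E σE (fun L : Loops => L.1) := CodeFP.fst _ _
  have hcells : CodeFP Loops.E (rawE natE) (fun L : Loops => L.2.1) := (CodeFP.snd _ _).fst'
  have hwords : CodeFP Loops.E (rawE natE) (fun L : Loops => L.2.2.1) := (CodeFP.snd _ _).snd'.fst'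
  have hf : CodeFP Loops.E (rawE RawGate.E) (fun L : Loops => fetchOver M (L.1, L.2.1)) :=
    codeFP_fetchOver.comp (hctx.pair hcells)
  have hm : CodeFP Loops.E (rawE RawGate.E) (fun L : Loops => moveOver M D (L.1, L.2.2.1)) :=
    (codeFP_moveOver D).comp (hctx.pair hwords)
  have hl : CodeFP Loops.E (rawE RawGate.E) (fun L : Loops => [locRawc M L.1]) :=
    (rawSingleton RawGate.E).comp (codeFP_locRawc.comp hctx)
  have happ := rawAppend RawGate.E
  exact (happ.comp (hf.pair (happ.comp (hl.pair (happ.comp (hf.pair hm)))))).congr fun _ => rfl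

/-- `yaoOver` on codes. [folklore] -/
theorem codeFP_yaoOver (D : M.Λ → Dir) : CodeFP (Loops.E) (rawE RawGate.E) (yaoOver M D) := by
  have hctx : CodeFP Loops.E σE (fun L : Loops => L.1) := CodeFP.fst _ _
  have hcells : CodeFP Loops.E (rawE natE) (fun L : Loops => L.2.1) := (CodeFP.snd _ _).fst'
  have hinputs : CodeFP Loops.E (rawE natE) (fun L : Loops => L.2.2.2.1) := (CodeFP.snd _ _).snd'.snd'.fst'
  have hsteps : CodeFP Loops.E unE (fun L : Loops => L.2.2.2.2) := (CodeFP.snd _ _).snd'.snd'.snd'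
  have hi : CodeFP Loops.E (rawE RawGate.E) (fun L : Loops => initOver M (L.1, (L.2.1, L.2.2.2.1))) :=
    codeFP_initOver.comp (hctx.pair (hcells.pair hinputs))
  have hrep : CodeFP Loops.E (rawE RawGate.E) (fun L : Loops => (List.replicate L.2.2.2.2 (stepOver M D L)).flatten) :=
    (flatten RawGate.E).comp ((replicateOf (rawE RawGate.E)).comp ((codeFP_stepOver D).pair hsteps))
  have ho : CodeFP Loops.E (rawE RawGate.E) (fun L : Loops => outputRaw M L.1) := codeFP_outputRaw.comp hctx
  have happ := rawAppend RawGate.E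
  exact (happ.comp (hi.pair (happ.comp (hrep.pair ho)))).congr fun _ => rfl

end Pieces

/-! ### The loops from the unary input, and uniformity -/

section Uniform

/-- **Polynomial evaluation on binary numerals is computed on codes.** [cite: AroraBarak2009, §1.3] -/
theorem codeFP_polyEval (R : Polynomial ℕ) : CodeFP natE natE (fun n => R.eval n) := by
  have hsum : ∀ d : ℕ, CodeFP natE natE (fun n => ∑ i ∈ Finset.range d, R.coeff i * n ^ i) := by
    intro d
    induction d with
    | zero => exact (CodeFP.const natE 0).congr fun n => by simp
    | succ d ih =>
      have hterm : CodeFP natE natE (fun n => R.coeff d * n ^ d) :=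
        natMul.comp ((CodeFP.const natE (R.coeff d)).pair (natPow.comp ((CodeFP.id natE).pair
          (CodeFP.const (eβ := unE) natE d))))
      exact (natAdd.comp (ih.pair hterm)).congr fun n => by rw [Finset.sum_range_succ]
  exact (hsum (R.natDegree + 1)).congr fun n => (Polynomial.eval_eq_sum_range n).symm

variable (M) (D : M.Λ → Dir) (p : Polynomial ℕ)

/-- The step count in binary, from the unary input. [folklore] -/
theorem codeFP_T_nat : CodeFP unE natE (fun n => p.eval n) := (codeFP_polyEval p).comp natOfUn

/-- Unary multiplication by a constant. [folklore] -/
theorem codeFP_unMulConst : ∀ c : ℕ, CodeFP unE unE (fun w => w * c)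
  | 0 => (CodeFP.const unE 0).congr fun w => by simp
  | c + 1 => (unAdd.comp ((codeFP_unMulConst c).pair (CodeFP.id unE))).congr fun w => by
      show w * c + w = w * (c + 1)
      ring

/-- The step count in unary, from the unary input (through a polynomial unit budget). [folklore] -/
theorem codeFP_T_un : CodeFP unE unE (fun n => p.eval n) := by
  obtain ⟨C, K, hCK⟩ := exists_eval_le_mul_pow_add p
  -- the unit budget `C (n+1)^K + C ≥ p(n)` (`Complexity.exists_eval_le_mul_pow_add`)
  have hpow : CodeFP unE unE (fun n => (n + 1) ^ K) :=
    ((ulength unitE).comp ((unitsPow K).comp unSucc)).congr fun n => by simp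
  have hbud : CodeFP unE unE (fun n => (n + 1) ^ K * C + C) :=
    unAdd.comp (((codeFP_unMulConst C).comp hpow).pair (CodeFP.const unE C))
  refine (unOfNatMin.comp (hbud.pair (codeFP_T_nat p))).congr fun n => min_eq_left ((hCK n).trans ?_)
  have : n ^ K ≤ (n + 1) ^ K := Nat.pow_le_pow_left (by omega) K
  nlinarith

/-- The window size in unary. [folklore] -/
theorem codeFP_W_un : CodeFP unE unE (fun n => Wd n (p.eval n)) :=
  (unAdd.comp ((unAdd.comp ((codeFP_T_un p).pair (codeFP_T_un p))).pair unSucc)).congr fun n => by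
    show p.eval n + p.eval n + (n + 1) = 2 * p.eval n + n + 1
    omega

/-- **The loops are computed on codes from the unary input.** [cite: AroraBarak2009, §1.3] -/
theorem codeFP_loopsOf : CodeFP unE (Loops.E) (fun n => loopsOf n (p.eval n)) := by
  have hctx : CodeFP unE σE (fun n => (n, p.eval n)) := natOfUn.pair (codeFP_T_nat p)
  have hcells : CodeFP unE (rawE natE) (fun n => List.range (Wd n (p.eval n))) := urange.comp (codeFP_W_un p)
  have hwords : CodeFP unE (rawE natE) (fun n => List.range (Wd n (p.eval n) - 1)) :=
    (rangeOf.comp ((codeFP_W_un p).pair (natSub.comp ((natOfUn.comp (codeFP_W_un p)).pair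
      (CodeFP.const unE 1))))).congr fun n => by
        show List.range (min (Wd n (p.eval n) - 1) (Wd n (p.eval n))) = _
        rw [min_eq_left (Nat.sub_le _ _)]
  have hinputs : CodeFP unE (rawE natE) (fun n => List.range n) := urange
  exact (hctx.pair (hcells.pair (hwords.pair (hinputs.pair (codeFP_T_un p))))).congr fun _ => rfl

/-- The number of ancillas in unary. [folklore] -/
theorem codeFP_anc_un : CodeFP unE unE (fun n => anc M (Wd n (p.eval n))) :=
  (unAdd.comp ((unAdd.comp ((CodeFP.const unE (kq M + ks M + 1 + 1)).pair
    ((codeFP_unMulConst (ks M)).comp (codeFP_W_un p)))).pair (codeFP_W_un p))).congr fun _ => rfl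

/-- **The raw description of the simulating family is computed on codes from the unary input.** [cite: AroraBarak2009, §6.2] -/
theorem codeFP_rawDesc_yaoFamily : CodeFP unE RawDesc.E (fun n => (yaoFamily M D p).rawDesc n) := by
  have h : CodeFP unE RawDesc.E (fun n => (n, (anc M (Wd n (p.eval n)), yaoOver M D (loopsOf n (p.eval n))))) :=
    natOfUn.pair ((codeFP_anc_un M p).pair ((codeFP_yaoOver D).comp (codeFP_loopsOf p)))
  exact h.congr fun n => by rw [rawDesc_yaoFamily, yaoRaw_eq_yaoOver]

/-- **The simulating family is polynomial-time uniform** (Nishimura–Ozawa 2002, §2.2 and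
Thm. 4.3: the circuits simulating a QTM form a polynomial-time uniform family — the code of the
`n`-th circuit is printed from `1ⁿ` in polynomial time). [cite: NishimuraOzawa2002, Thm. 4.3] -/
theorem isUniform_yaoFamily : (yaoFamily M D p).IsUniform := by
  rw [QCircuitFamily.isUniform_iff_descFn_mem_FP]
  obtain ⟨f, hf, hfe⟩ := codeFP_rawDesc_yaoFamily M D p
  have h : (yaoFamily M D p).descFn = f ∘ onesFn := funext fun z => by
    rw [Function.comp_apply, QCircuitFamily.descFn_eq_E_rawDesc, onesFn, ← hfe]
  rw [h]
  exact comp_mem_FP hf onesFn_mem_FP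

end Uniform

end YaoSim

end Literature.Computability.QuantumComplexity

end
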